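import Literature.AlgebraicGeometry.Morphisms.SectionsFpqcDescent
import Literature.AlgebraicGeometry.Modules.PullbackSectionsBaseChange
import Literature.RingTheory.Flat.FaithfullyFlatPi
import Mathlib.AlgebraicGeometry.Morphisms.QuasiCompact
import HarnessLib

/-!
# Sections of a quasi-coherent module form an fpqc sheaf, III a: the affine pieces of a quasi-compact cover

Topic `Literature/AlgebraicGeometry/Morphisms`, namespace `Literature.AlgebraicGeometry.Morphisms`.  THEOREMS ONLY; no
definition, no named fact, no instance, no notation, no `sorry`.

[SGA1] Exp. VIII Thm. 1.1 / [StacksProject, Tag 023M] / [GortzWedhorn2020] Prop. 14.66 for `g : Z → X` flat, surjective and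
QUASI-COMPACT: over an affine `V ⊆ X` the quasi-compact open `g⁻¹V` is a finite union of affine opens `U_i`, and the
descent of sections runs through the faithfully flat ring map `Γ(V) → ∏ Γ(U_i)` ([StacksProject, Tag 023M]: «we may assume
the covering is given by a single faithfully flat ring map»).  This file holds the chart plumbing for affine pieces
`U, U' ⊆ g⁻¹V` of a kernel pair `p₁, p₂ : Z₂ ⇉ Z` (`IsPullback p₁ p₂ g g`):

* `exists_ringEquiv_tensorProduct_kernelPair_of_le`, `bijective_lift_kernelPair_of_le` —
  `Γ(p₁⁻¹U ∩ p₂⁻¹U') = Γ(U) ⊗_{Γ(V)} Γ(U')` through `p₁^♯, p₂^♯` (Mathlib `isIso_pushoutSection_of_isAffineOpen`; ★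
  `exists_ringEquiv_tensorProduct_kernelPair` of `Morphisms/SectionsFpqcDescentChart` is the case `U = U' = g⁻¹V`);
* `exists_comap_appLE_eq_of_iSup`, **`faithfullyFlat_pi_appLE`** — every prime of `Γ(V)` lies under a prime of some
  `Γ(U_i)`, so `Γ(V) → ∏ Γ(U_i)` is faithfully flat (Mathlib `Flat.flat_appLE`, ★ `RingTheory/Flat/FaithfullyFlatPi`);
* `cofaceFst_map_of_le`, `cofaceSnd_map_of_le`, `cofaceFst_unitSectionLE`, `cofaceSnd_unitSectionLE`,
  `cofaceFst_smul_of_le`, `cofaceSnd_smul_of_le` — the two cofaces `s ↦ p₁^*s|`, `s ↦ p₂^*s|` read on a piece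
  `p₁⁻¹U ∩ p₂⁻¹U'`: compatibility with restriction from `U₂(V) = p₁⁻¹g⁻¹V ∩ p₂⁻¹g⁻¹V`, value on pulled-back sections,
  `p₁^♯`/`p₂^♯`-semilinearity (★ `unitSection_map`, `pullbackComp_hom_app_unitSection`, `pullbackCongr_hom_app_unitSection`).

The chart and global statements are `Morphisms/SectionsFpqcDescentQuasiCompact`.  HC_CM is proved only modulo the 7 printed
citations until rung 0 closes; nothing here is about HC.

## References
* [SGA1] A. Grothendieck, *SGA 1*, Exp. VIII §1, Thm. 1.1, Cor. 1.2.
* [StacksProject] The Stacks Project, Tag 023M (Descent, Lemma 35.3.6), Tag 00HQ.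
* [GortzWedhorn2020] U. Görtz, T. Wedhorn, *Algebraic Geometry I*, 2nd ed. (2020), Prop. 14.66, Thm. 14.68.
-/

noncomputable section

-- `TopCat.Presheaf`/`Scheme.Modules` are not reducible (as in Mathlib's `AlgebraicGeometry/Modules`).
set_option backward.isDefEq.respectTransparency false

universe u

open CategoryTheory CategoryTheory.Limits AlgebraicGeometry TopologicalSpace Opposite TensorProduct

namespace Literature.AlgebraicGeometry.Morphisms

open Literature.AlgebraicGeometry.Modules Literature.RingTheory.Flat

variable {X Z Z₂ : Scheme.{u}} (g : Z ⟶ X) (p₁ p₂ : Z₂ ⟶ Z) (M : X.Modules)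

/-! ### §1 Chart plumbing for affine opens `U ⊆ g⁻¹V` -/

section Pieces

variable {V : X.Opens}

/-- **`Γ(p₁⁻¹U₁ ∩ p₂⁻¹U₂) = Γ(U₁) ⊗_{Γ(V)} Γ(U₂)` through `p₁^♯`, `p₂^♯`** for affine `U₁, U₂ ⊆ g⁻¹V` and `V` affine (Mathlib
`isIso_pushoutSection_of_isAffineOpen` for the cartesian square `Z₂ ⇉ Z → X`, compared with the explicit pushout
`CommRingCat.isPushout_tensorProduct`; ★ `exists_ringEquiv_tensorProduct_kernelPair` is the case `U₁ = U₂ = g⁻¹V`).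
[cite: StacksProject, Tag 023M] -/
theorem exists_ringEquiv_tensorProduct_kernelPair_of_le (H₂ : IsPullback p₁ p₂ g g) (hV : IsAffineOpen V)
    {U₁ U₂ : Z.Opens} (h₁ : U₁ ≤ g ⁻¹ᵁ V) (h₂ : U₂ ≤ g ⁻¹ᵁ V) (hU₁ : IsAffineOpen U₁) (hU₂ : IsAffineOpen U₂) :
    letI := (g.appLE V U₁ h₁).hom.toAlgebra
    letI := (g.appLE V U₂ h₂).hom.toAlgebra
    ∃ e : Γ(Z, U₁) ⊗[Γ(X, V)] Γ(Z, U₂) ≃+* Γ(Z₂, p₁ ⁻¹ᵁ U₁ ⊓ p₂ ⁻¹ᵁ U₂),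
      (∀ a, e (a ⊗ₜ 1) = p₁.appLE U₁ (p₁ ⁻¹ᵁ U₁ ⊓ p₂ ⁻¹ᵁ U₂) inf_le_left a) ∧
      (∀ b, e (1 ⊗ₜ b) = p₂.appLE U₂ (p₁ ⁻¹ᵁ U₁ ⊓ p₂ ⁻¹ᵁ U₂) inf_le_right b) := by
  letI := (g.appLE V U₁ h₁).hom.toAlgebra
  letI := (g.appLE V U₂ h₂).hom.toAlgebra
  have H := (isIso_pushoutSection_iff H₂ h₂ h₁ (rfl : p₁ ⁻¹ᵁ U₁ ⊓ p₂ ⁻¹ᵁ U₂ = p₁ ⁻¹ᵁ U₁ ⊓ p₂ ⁻¹ᵁ U₂)).mp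
    (isIso_pushoutSection_of_isAffineOpen H₂ h₂ h₁ rfl hV hU₂ hU₁)
  let e := ((CommRingCat.isPushout_tensorProduct Γ(X, V) Γ(Z, U₁) Γ(Z, U₂)).isoIsPushout _ _ H)
  refine ⟨e.commRingCatIsoToRingEquiv, fun a => ?_, fun b => ?_⟩
  · have h := (CommRingCat.isPushout_tensorProduct Γ(X, V) Γ(Z, U₁) Γ(Z, U₂)).inl_isoIsPushout_hom _ _ H
    exact congr($(h).hom a)
  · have h := (CommRingCat.isPushout_tensorProduct Γ(X, V) Γ(Z, U₁) Γ(Z, U₂)).inr_isoIsPushout_hom _ _ H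
    exact congr($(h).hom b)

/-- **The kernel-pair presentation on a pair of affine pieces**: for `Γ(V)`-algebra maps `φ₁ : Γ(U₁) → Γ(p₁⁻¹U₁ ∩ p₂⁻¹U₂)`,
`φ₂ : Γ(U₂) → Γ(p₁⁻¹U₁ ∩ p₂⁻¹U₂)` that are `p₁^♯`, `p₂^♯` pointwise, `lift φ₁ φ₂ : Γ(U₁) ⊗_{Γ(V)} Γ(U₂) → Γ(p₁⁻¹U₁ ∩ p₂⁻¹U₂)`
is bijective (`exists_ringEquiv_tensorProduct_kernelPair_of_le`, compared on pure tensors). [cite: StacksProject, Tag 023M] -/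
theorem bijective_lift_kernelPair_of_le (H₂ : IsPullback p₁ p₂ g g) (hV : IsAffineOpen V)
    {U₁ U₂ : Z.Opens} (h₁ : U₁ ≤ g ⁻¹ᵁ V) (h₂ : U₂ ≤ g ⁻¹ᵁ V) (hU₁ : IsAffineOpen U₁) (hU₂ : IsAffineOpen U₂)
    (h₁₂ : p₁ ⁻¹ᵁ U₁ ⊓ p₂ ⁻¹ᵁ U₂ ≤ (p₁ ≫ g) ⁻¹ᵁ V) :
    letI := (g.appLE V U₁ h₁).hom.toAlgebra
    letI := (g.appLE V U₂ h₂).hom.toAlgebra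
    letI := ((p₁ ≫ g).appLE V (p₁ ⁻¹ᵁ U₁ ⊓ p₂ ⁻¹ᵁ U₂) h₁₂).hom.toAlgebra
    ∀ (φ₁ : Γ(Z, U₁) →ₐ[Γ(X, V)] Γ(Z₂, p₁ ⁻¹ᵁ U₁ ⊓ p₂ ⁻¹ᵁ U₂))
      (φ₂ : Γ(Z, U₂) →ₐ[Γ(X, V)] Γ(Z₂, p₁ ⁻¹ᵁ U₁ ⊓ p₂ ⁻¹ᵁ U₂)),
      (∀ a, φ₁ a = p₁.appLE U₁ (p₁ ⁻¹ᵁ U₁ ⊓ p₂ ⁻¹ᵁ U₂) inf_le_left a) →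
      (∀ b, φ₂ b = p₂.appLE U₂ (p₁ ⁻¹ᵁ U₁ ⊓ p₂ ⁻¹ᵁ U₂) inf_le_right b) →
      Function.Bijective (Algebra.TensorProduct.lift φ₁ φ₂ fun _ _ => Commute.all _ _) := by
  letI := (g.appLE V U₁ h₁).hom.toAlgebra
  letI := (g.appLE V U₂ h₂).hom.toAlgebra
  letI := ((p₁ ≫ g).appLE V (p₁ ⁻¹ᵁ U₁ ⊓ p₂ ⁻¹ᵁ U₂) h₁₂).hom.toAlgebra
  intro φ₁ φ₂ hφ₁ hφ₂
  obtain ⟨e, he₁, he₂⟩ := exists_ringEquiv_tensorProduct_kernelPair_of_le g p₁ p₂ H₂ hV h₁ h₂ hU₁ hU₂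
  have hlift : ∀ x, Algebra.TensorProduct.lift φ₁ φ₂ (fun _ _ => Commute.all _ _) x = e x := by
    intro x
    induction x using TensorProduct.induction_on with
    | zero => simp
    | tmul a b =>
        have hab : a ⊗ₜ[Γ(X, V)] b = (a ⊗ₜ[Γ(X, V)] 1) * (1 ⊗ₜ[Γ(X, V)] b) := by
          rw [Algebra.TensorProduct.tmul_mul_tmul, mul_one, one_mul]
        rw [Algebra.TensorProduct.lift_tmul, hab, map_mul, he₁, he₂, hφ₁, hφ₂]
    | add x y hx hy => rw [map_add, map_add, hx, hy]
  rw [show ⇑(Algebra.TensorProduct.lift φ₁ φ₂ (fun _ _ => Commute.all _ _)) = ⇑e from funext hlift]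
  exact e.bijective

/-- **Every closed point of `V` lies under SOME affine piece**: for `g` surjective, `V` affine and affine opens
`U_i ⊆ g⁻¹V` covering `g⁻¹V`, every prime of `Γ(V)` is the contraction of a prime of some `Γ(U_i)` along `g^♯` (the charts
`fromSpec`, Mathlib `IsAffineOpen.SpecMap_appLE_fromSpec`). [cite: StacksProject, Tag 00HQ] [cite: GortzWedhorn2020, Thm. 14.68] -/
theorem exists_comap_appLE_eq_of_iSup [Surjective g] (hV : IsAffineOpen V) {ι : Type*} (U : ι → Z.Opens)
    (hUV : ∀ i, U i ≤ g ⁻¹ᵁ V) (hUaff : ∀ i, IsAffineOpen (U i)) (hcov : g ⁻¹ᵁ V ≤ ⨆ i, U i)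
    (y : PrimeSpectrum Γ(X, V)) :
    ∃ (i : ι) (w : PrimeSpectrum Γ(Z, U i)), PrimeSpectrum.comap (g.appLE V (U i) (hUV i)).hom w = y := by
  obtain ⟨z, hz⟩ := g.surjective (hV.fromSpec.base y)
  have hzV : z ∈ g ⁻¹ᵁ V := by
    change g.base z ∈ (V : Set X)
    rw [hz, ← hV.range_fromSpec]
    exact Set.mem_range_self y
  obtain ⟨i, hzi⟩ := Opens.mem_iSup.mp (hcov hzV)
  have hzU : z ∈ Set.range (hUaff i).fromSpec.base := by
    rw [(hUaff i).range_fromSpec]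
    exact hzi
  obtain ⟨w, rfl⟩ := hzU
  refine ⟨i, w, hV.fromSpec.isOpenEmbedding.injective ?_⟩
  have hsq := congrArg (fun φ => φ.base w) (IsAffineOpen.SpecMap_appLE_fromSpec g hV (hUaff i) (hUV i))
  simp only [Scheme.Hom.comp_base, TopCat.coe_comp, Function.comp_apply] at hsq
  rw [← hz, ← hsq]
  rfl

/-- **`Γ(V) → ∏ Γ(U_i)` is faithfully flat** for `g` flat and surjective, `V` affine and finitely many affine opens
`U_i ⊆ g⁻¹V` covering `g⁻¹V` (flat piece by piece, Mathlib `Flat.flat_appLE`; every maximal ideal of `Γ(V)` lies under a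
prime of some `Γ(U_i)`, `exists_comap_appLE_eq_of_iSup`; ★ `faithfullyFlat_pi_of_liesOver`), for the factorwise algebra
structure through `g^♯`. [cite: StacksProject, Tag 023M] [cite: GortzWedhorn2020, Thm. 14.68] -/
theorem faithfullyFlat_pi_appLE [Flat g] [Surjective g] (hV : IsAffineOpen V) {ι : Type*} [Finite ι] (U : ι → Z.Opens)
    (hUV : ∀ i, U i ≤ g ⁻¹ᵁ V) (hUaff : ∀ i, IsAffineOpen (U i)) (hcov : g ⁻¹ᵁ V ≤ ⨆ i, U i) :
    letI : ∀ i, Algebra Γ(X, V) Γ(Z, U i) := fun i => (g.appLE V (U i) (hUV i)).hom.toAlgebra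
    Module.FaithfullyFlat Γ(X, V) (Π i, Γ(Z, U i)) := by
  letI : ∀ i, Algebra Γ(X, V) Γ(Z, U i) := fun i => (g.appLE V (U i) (hUV i)).hom.toAlgebra
  haveI : ∀ i, Module.Flat Γ(X, V) Γ(Z, U i) := fun i => g.flat_appLE hV (hUaff i) (hUV i)
  refine faithfullyFlat_pi_of_liesOver (R := Γ(X, V)) (fun i => Γ(Z, U i)) fun m hm => ?_
  obtain ⟨i, w, hw⟩ := exists_comap_appLE_eq_of_iSup g hV U hUV hUaff hcov ⟨m, hm.isPrime⟩
  exact ⟨i, w.asIdeal, w.isPrime, congrArg PrimeSpectrum.asIdeal hw⟩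

/-- **The first coface commutes with restriction to a piece**: for `U, U' ⊆ g⁻¹V` and `s ∈ Γ(g⁻¹V, g^*M)`,
`p₁^*(s|_U)|_{p₁⁻¹U ∩ p₂⁻¹U'} = (p₁^*s|_{U₂(V)})|_{p₁⁻¹U ∩ p₂⁻¹U'}` (`U₂(V) = p₁⁻¹g⁻¹V ∩ p₂⁻¹g⁻¹V`; naturality of `pullbackComp`
in the open, ★ `unitSection_map`). [cite: StacksProject, Tag 023M] -/
theorem cofaceFst_map_of_le {U U' : Z.Opens} (hU : U ≤ g ⁻¹ᵁ V) (hU' : U' ≤ g ⁻¹ᵁ V)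
    (s : Γ((Scheme.Modules.pullback g).obj M, g ⁻¹ᵁ V)) :
    ((Scheme.Modules.pullback (p₁ ≫ g)).obj M).presheaf.map
        (homOfLE (inf_le_left : p₁ ⁻¹ᵁ U ⊓ p₂ ⁻¹ᵁ U' ≤ p₁ ⁻¹ᵁ U)).op
        (((Scheme.Modules.pullbackComp p₁ g).hom.app M).app (p₁ ⁻¹ᵁ U)
          (unitSection p₁ ((Scheme.Modules.pullback g).obj M) U
            (((Scheme.Modules.pullback g).obj M).presheaf.map (homOfLE hU).op s))) =
      ((Scheme.Modules.pullback (p₁ ≫ g)).obj M).presheaf.map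
        (homOfLE (inf_le_inf (p₁.preimage_mono hU) (p₂.preimage_mono hU'))).op
        (((Scheme.Modules.pullback (p₁ ≫ g)).obj M).presheaf.map
          (homOfLE (inf_le_left : p₁ ⁻¹ᵁ (g ⁻¹ᵁ V) ⊓ p₂ ⁻¹ᵁ (g ⁻¹ᵁ V) ≤ p₁ ⁻¹ᵁ (g ⁻¹ᵁ V))).op
          (((Scheme.Modules.pullbackComp p₁ g).hom.app M).app (p₁ ⁻¹ᵁ (g ⁻¹ᵁ V))
            (unitSection p₁ ((Scheme.Modules.pullback g).obj M) (g ⁻¹ᵁ V) s))) := by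
  have nat := app_presheaf_map (M := (Scheme.Modules.pullback p₁).obj ((Scheme.Modules.pullback g).obj M))
    (N := (Scheme.Modules.pullback (p₁ ≫ g)).obj M) ((Scheme.Modules.pullbackComp p₁ g).hom.app M)
    ((Opens.map p₁.base).map (homOfLE hU)) (unitSection p₁ ((Scheme.Modules.pullback g).obj M) (g ⁻¹ᵁ V) s)
  rw [unitSection_map]
  erw [nat]
  conv_lhs => rw [← CategoryTheory.comp_apply, ← Functor.map_comp, ← op_comp]
  conv_rhs => rw [← CategoryTheory.comp_apply, ← Functor.map_comp, ← op_comp]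
  exact presheaf_map_congr _ _ _ _

/-- **The second coface commutes with restriction to a piece**: for `U, U' ⊆ g⁻¹V` and `s ∈ Γ(g⁻¹V, g^*M)`,
`p₂^*(s|_{U'})|_{p₁⁻¹U ∩ p₂⁻¹U'} = (p₂^*s|_{U₂(V)})|_{p₁⁻¹U ∩ p₂⁻¹U'}` in `(p₁ ≫ g)^*M` (through `pullbackCongr`).
[cite: StacksProject, Tag 023M] -/
theorem cofaceSnd_map_of_le (H : p₂ ≫ g = p₁ ≫ g) {U U' : Z.Opens} (hU : U ≤ g ⁻¹ᵁ V) (hU' : U' ≤ g ⁻¹ᵁ V)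
    (s : Γ((Scheme.Modules.pullback g).obj M, g ⁻¹ᵁ V)) :
    ((Scheme.Modules.pullback (p₁ ≫ g)).obj M).presheaf.map
        (homOfLE (inf_le_right : p₁ ⁻¹ᵁ U ⊓ p₂ ⁻¹ᵁ U' ≤ p₂ ⁻¹ᵁ U')).op
        (((Scheme.Modules.pullbackCongr H).hom.app M).app (p₂ ⁻¹ᵁ U')
          (((Scheme.Modules.pullbackComp p₂ g).hom.app M).app (p₂ ⁻¹ᵁ U')
            (unitSection p₂ ((Scheme.Modules.pullback g).obj M) U'
              (((Scheme.Modules.pullback g).obj M).presheaf.map (homOfLE hU').op s)))) =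
      ((Scheme.Modules.pullback (p₁ ≫ g)).obj M).presheaf.map
        (homOfLE (inf_le_inf (p₁.preimage_mono hU) (p₂.preimage_mono hU'))).op
        (((Scheme.Modules.pullback (p₁ ≫ g)).obj M).presheaf.map
          (homOfLE (inf_le_right : p₁ ⁻¹ᵁ (g ⁻¹ᵁ V) ⊓ p₂ ⁻¹ᵁ (g ⁻¹ᵁ V) ≤ p₂ ⁻¹ᵁ (g ⁻¹ᵁ V))).op
          (((Scheme.Modules.pullbackCongr H).hom.app M).app (p₂ ⁻¹ᵁ (g ⁻¹ᵁ V))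
            (((Scheme.Modules.pullbackComp p₂ g).hom.app M).app (p₂ ⁻¹ᵁ (g ⁻¹ᵁ V))
              (unitSection p₂ ((Scheme.Modules.pullback g).obj M) (g ⁻¹ᵁ V) s)))) := by
  have nat := app_presheaf_map (M := (Scheme.Modules.pullback p₂).obj ((Scheme.Modules.pullback g).obj M))
    (N := (Scheme.Modules.pullback (p₂ ≫ g)).obj M) ((Scheme.Modules.pullbackComp p₂ g).hom.app M)
    ((Opens.map p₂.base).map (homOfLE hU')) (unitSection p₂ ((Scheme.Modules.pullback g).obj M) (g ⁻¹ᵁ V) s)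
  have nat' := app_presheaf_map (M := (Scheme.Modules.pullback (p₂ ≫ g)).obj M) (N := (Scheme.Modules.pullback (p₁ ≫ g)).obj M)
    ((Scheme.Modules.pullbackCongr H).hom.app M) ((Opens.map p₂.base).map (homOfLE hU'))
    (((Scheme.Modules.pullbackComp p₂ g).hom.app M).app (p₂ ⁻¹ᵁ (g ⁻¹ᵁ V))
      (unitSection p₂ ((Scheme.Modules.pullback g).obj M) (g ⁻¹ᵁ V) s))
  rw [unitSection_map]
  refine (congrArg (fun y => ((Scheme.Modules.pullback (p₁ ≫ g)).obj M).presheaf.map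
    (homOfLE (inf_le_right : p₁ ⁻¹ᵁ U ⊓ p₂ ⁻¹ᵁ U' ≤ p₂ ⁻¹ᵁ U')).op
    (((Scheme.Modules.pullbackCongr H).hom.app M).app (p₂ ⁻¹ᵁ U') y)) nat).trans ?_
  refine (congrArg (fun y => ((Scheme.Modules.pullback (p₁ ≫ g)).obj M).presheaf.map
    (homOfLE (inf_le_right : p₁ ⁻¹ᵁ U ⊓ p₂ ⁻¹ᵁ U' ≤ p₂ ⁻¹ᵁ U')).op y) nat').trans ?_
  conv_lhs => rw [← CategoryTheory.comp_apply, ← Functor.map_comp, ← op_comp]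
  conv_rhs => rw [← CategoryTheory.comp_apply, ← Functor.map_comp, ← op_comp]
  exact presheaf_map_congr _ _ _ _

/-- **The first coface of a pulled-back section, on a piece**: `p₁^*(η_g(m)|_U)|_{p₁⁻¹U ∩ p₂⁻¹U'} = η_{p₁ ≫ g}(m)|_{p₁⁻¹U ∩ p₂⁻¹U'}`
(`cofaceFst_map_of_le` and ★ `cofaceFst_unitSection`). [cite: StacksProject, Tag 023M] -/
theorem cofaceFst_unitSectionLE {U U' : Z.Opens} (hU : U ≤ g ⁻¹ᵁ V) (hU' : U' ≤ g ⁻¹ᵁ V)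
    (h₂ : p₁ ⁻¹ᵁ U ⊓ p₂ ⁻¹ᵁ U' ≤ (p₁ ≫ g) ⁻¹ᵁ V) (m : Γ(M, V)) :
    ((Scheme.Modules.pullback (p₁ ≫ g)).obj M).presheaf.map
        (homOfLE (inf_le_left : p₁ ⁻¹ᵁ U ⊓ p₂ ⁻¹ᵁ U' ≤ p₁ ⁻¹ᵁ U)).op
        (((Scheme.Modules.pullbackComp p₁ g).hom.app M).app (p₁ ⁻¹ᵁ U)
          (unitSection p₁ ((Scheme.Modules.pullback g).obj M) U (unitSectionLE g M hU m))) =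
      unitSectionLE (p₁ ≫ g) M h₂ m := by
  rw [unitSectionLE, cofaceFst_map_of_le g p₁ p₂ M hU hU', cofaceFst_unitSection g p₁ p₂ M m, unitSectionLE,
    unitSectionLE, ← CategoryTheory.comp_apply, ← Functor.map_comp, ← op_comp]
  exact presheaf_map_congr _ _ _ _

/-- **The second coface of a pulled-back section, on a piece**: `p₂^*(η_g(m)|_{U'})|_{p₁⁻¹U ∩ p₂⁻¹U'} = η_{p₁ ≫ g}(m)|_{…}`
in `(p₁ ≫ g)^*M` (`cofaceSnd_map_of_le` and ★ `cofaceSnd_unitSection`). [cite: StacksProject, Tag 023M] -/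
theorem cofaceSnd_unitSectionLE (H : p₂ ≫ g = p₁ ≫ g) {U U' : Z.Opens} (hU : U ≤ g ⁻¹ᵁ V) (hU' : U' ≤ g ⁻¹ᵁ V)
    (h₂ : p₁ ⁻¹ᵁ U ⊓ p₂ ⁻¹ᵁ U' ≤ (p₁ ≫ g) ⁻¹ᵁ V) (m : Γ(M, V)) :
    ((Scheme.Modules.pullback (p₁ ≫ g)).obj M).presheaf.map
        (homOfLE (inf_le_right : p₁ ⁻¹ᵁ U ⊓ p₂ ⁻¹ᵁ U' ≤ p₂ ⁻¹ᵁ U')).op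
        (((Scheme.Modules.pullbackCongr H).hom.app M).app (p₂ ⁻¹ᵁ U')
          (((Scheme.Modules.pullbackComp p₂ g).hom.app M).app (p₂ ⁻¹ᵁ U')
            (unitSection p₂ ((Scheme.Modules.pullback g).obj M) U' (unitSectionLE g M hU' m)))) =
      unitSectionLE (p₁ ≫ g) M h₂ m := by
  rw [unitSectionLE, cofaceSnd_map_of_le g p₁ p₂ M H hU hU', cofaceSnd_unitSection g p₁ p₂ M H m, unitSectionLE,
    unitSectionLE, ← CategoryTheory.comp_apply, ← Functor.map_comp, ← op_comp]
  exact presheaf_map_congr _ _ _ _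

/-- `appLE` along equal morphisms (the proof slots are irrelevant). [cite: StacksProject, Tag 023M] -/
theorem appLE_congr_of_eq {Y : Scheme.{u}} {f₁ f₂ : Z₂ ⟶ Y} (h : f₁ = f₂) (U : Y.Opens) (W : Z₂.Opens)
    (e₁ : W ≤ f₁ ⁻¹ᵁ U) (e₂ : W ≤ f₂ ⁻¹ᵁ U) : f₁.appLE U W e₁ = f₂.appLE U W e₂ := by
  subst h
  rfl

/-- **The first coface on a piece is `p₁^♯`-semilinear**: `p₁^*((c·t))|_{p₁⁻¹U ∩ p₂⁻¹U'} = p₁^♯(c) · p₁^*(t)|_{…}`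
(★ `unitSection_smul`). [cite: StacksProject, Tag 023M] -/
theorem cofaceFst_smul_of_le (U U' : Z.Opens) (c : Γ(Z, U)) (t : Γ((Scheme.Modules.pullback g).obj M, U)) :
    ((Scheme.Modules.pullback (p₁ ≫ g)).obj M).presheaf.map
        (homOfLE (inf_le_left : p₁ ⁻¹ᵁ U ⊓ p₂ ⁻¹ᵁ U' ≤ p₁ ⁻¹ᵁ U)).op
        (((Scheme.Modules.pullbackComp p₁ g).hom.app M).app (p₁ ⁻¹ᵁ U)
          (unitSection p₁ ((Scheme.Modules.pullback g).obj M) U (c • t))) =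
      p₁.appLE U (p₁ ⁻¹ᵁ U ⊓ p₂ ⁻¹ᵁ U') inf_le_left c •
        ((Scheme.Modules.pullback (p₁ ≫ g)).obj M).presheaf.map
          (homOfLE (inf_le_left : p₁ ⁻¹ᵁ U ⊓ p₂ ⁻¹ᵁ U' ≤ p₁ ⁻¹ᵁ U)).op
          (((Scheme.Modules.pullbackComp p₁ g).hom.app M).app (p₁ ⁻¹ᵁ U)
            (unitSection p₁ ((Scheme.Modules.pullback g).obj M) U t)) := by
  rw [unitSection_smul, Scheme.Modules.Hom.app_smul, Scheme.Modules.map_smul]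
  rfl

/-- **The second coface on a piece is `p₂^♯`-semilinear** (in `(p₁ ≫ g)^*M`, through `pullbackCongr`; ★ `unitSection_smul`).
[cite: StacksProject, Tag 023M] -/
theorem cofaceSnd_smul_of_le (H : p₂ ≫ g = p₁ ≫ g) (U U' : Z.Opens) (c : Γ(Z, U'))
    (t : Γ((Scheme.Modules.pullback g).obj M, U')) :
    ((Scheme.Modules.pullback (p₁ ≫ g)).obj M).presheaf.map
        (homOfLE (inf_le_right : p₁ ⁻¹ᵁ U ⊓ p₂ ⁻¹ᵁ U' ≤ p₂ ⁻¹ᵁ U')).op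
        (((Scheme.Modules.pullbackCongr H).hom.app M).app (p₂ ⁻¹ᵁ U')
          (((Scheme.Modules.pullbackComp p₂ g).hom.app M).app (p₂ ⁻¹ᵁ U')
            (unitSection p₂ ((Scheme.Modules.pullback g).obj M) U' (c • t)))) =
      p₂.appLE U' (p₁ ⁻¹ᵁ U ⊓ p₂ ⁻¹ᵁ U') inf_le_right c •
        ((Scheme.Modules.pullback (p₁ ≫ g)).obj M).presheaf.map
          (homOfLE (inf_le_right : p₁ ⁻¹ᵁ U ⊓ p₂ ⁻¹ᵁ U' ≤ p₂ ⁻¹ᵁ U')).op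
          (((Scheme.Modules.pullbackCongr H).hom.app M).app (p₂ ⁻¹ᵁ U')
            (((Scheme.Modules.pullbackComp p₂ g).hom.app M).app (p₂ ⁻¹ᵁ U')
              (unitSection p₂ ((Scheme.Modules.pullback g).obj M) U' t))) := by
  rw [unitSection_smul, Scheme.Modules.Hom.app_smul, Scheme.Modules.Hom.app_smul, Scheme.Modules.map_smul]
  rfl

end Pieces

end Literature.AlgebraicGeometry.Morphisms

end
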